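import Mathlib
import Summits.ValiantsHypothesis.ValiantsHypothesis.Theorems.KPlusLogSqLawTropicalBMultiExchange
import Summits.ValiantsHypothesis.ValiantsHypothesis.Theorems.KPlusLogSqLawTropicalBAtomBudget

/-!
# Route «KPlusLogSqLaw», crux `TropicalB` (stmt-ValiantsHypothesis-19771) — the NO-RETURN LAW:
# a rotation register that has been dominant at two consecutive offsets never comes HOME again (a three-body exchange, every size)

HONEST FRAMING.  Helper file (cell `pub-symmetroid`, seat val-sym-trop-p1 g31, 2026-08-29) `--supports` the crux
`Summit.ValiantsHypothesis.ValiantsHypothesis.Theses.KPlusLogSqLaw.TropicalB` (item `stmt-ValiantsHypothesis-19771`, registered stubs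
`stub_tropThin` / `stub_tropFat` of `Cruxes/TropicalB/Lines/birth.lean`).  A STRUCTURE law (a NO-GO for one family of architectures) valid in
every design of every format; an instance, for all sizes at once, of the cell's multi-exchange law `MultiExchange.prefix_deficit` (val-sym-trop-p4 g5).
Def-free.  Nothing here bounds `TropicalB`; nothing bears on `WeakLifting`, DoorA26 / DoorA34, `MatrixDescartes` (stmt-ValiantsHypothesis-18050) or
VP ≠ VNP.

THE PATTERN.  Fix `n ≥ 1` and `n + 2` distinct «support» columns `s₀, …, s_{n+1}` (in a ring of `p = 2n+3` columns `c₀,…,c_{p−1}` read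
`s_i = c_{2i+1}` for `i ≤ n−1`, `s_n = c_{p−2}`, `s_{n+1} = c_{p−1}`).  Three terms `A`, `B`, `C`: `C` is «HOME» on the support (its rows there are
the reference rows `h_i := C.1 s_i`), `B` is «TWO STEPS OUT»: `B.1 s₀ = h_{n+1}`, `B.1 s_{i+1} = h_i` (`i < n`), `B.1 s_{n+1} = A.1 s_n`, and `A` is «ONE STEP
OUT» where it matters: `A.1 s_{n+1} = h_n` (in the ring: `A = ` rotation by one, `B = ` rotation by two, `C = ` any term with rows `r₁ … r_{p−1}` back home).
Exponent bookkeeping (the wrap classes of the ring give exactly this): `d(C.2 s_n) + d(B.2 s_{n+1}) ≤ d(A.2 s_n) + d(A.2 s_{n+1})` and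
`Σ_{i ≤ n+1} d(C.2 s_i) ≤ Σ_{i ≤ n} d(B.2 s_i) + d(A.2 s_{n+1})` («home cells are exponent-minimal in their columns; `B` carries one wrap at `s₀`»).

* `NoReturn.no_return` — **under these hypotheses `A`, `B`, `C` are never unique optima at slopes `θ_A ≤ θ_B ≤ θ_C` of one design.**
  Proof: the three HYBRID terms `qA = A ∘ (s_n s_{n+1})`, `qB = B ∘ ρ`, `qC = C ∘ ρ⁻¹` (`ρ` the cyclic shift `s_i ↦ s_{i+1}` of the support columns,
  extended by the identity), with classes read off the term owning each incidence, redistribute the incidences of `A, B, C` column by column (a Latin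
  triple), are present, and have prefix slope excesses `e_A ≥ 0`, `e_A + e_B ≥ 0`; `MultiExchange.prefix_deficit` (`t = 3`) refutes that.
* `NoReturn.no_return_uniform` — the same with the bookkeeping hypotheses replaced by the pointwise ones `d(C.2 s_i) ≤ d(B.2 s_i)` (`i ≤ n`),
  `d(C.2 s_{n+1}) ≤ d(A.2 s_{n+1})`, `d(C.2 s_n) + d(B.2 s_{n+1}) ≤ d(A.2 s_n) + d(A.2 s_{n+1})`.
READING (located origin: seat memo HOME/val-sym-trop-p1/g31/REUSE-g31.md §3–§3b): the single-species ROTATION RING with injection — a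
reusable middle digit, PCM-clean for all pairs — is LP-dead; its smallest kernels are Latin triples, and this one says: once a ring has been
the unique optimum at offsets 1 and 2, no later unique optimum has the ring rows back home, whatever else the term does (`n = (p−3)/2`,
every odd `p ≥ 5`).  A rotation digit is single-use in EVERY design.  [this seat; the exchange argument is the cell's `prefix_deficit`]
-/

set_option linter.dupNamespace false
set_option autoImplicit false

namespace Summit.ValiantsHypothesis.ValiantsHypothesis.Theorems.KPlusLogSqLaw

open Summit.ValiantsHypothesis.ValiantsHypothesis.Theorems.MatrixDescartes.Negative
open Finset

namespace NoReturn

variable {m K : ℕ}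

/-! ## 1. Small bookkeeping -/

/-- a count over `range 3` is the sum of three indicators. [folklore] -/
theorem card_filter_range_three (q : ℕ → Prop) [DecidablePred q] :
    ((range 3).filter q).card = (if q 0 then 1 else 0) + (if q 1 then 1 else 0) + (if q 2 then 1 else 0) := by
  simp only [Finset.card_filter, Finset.sum_range_succ, Finset.sum_range_zero, zero_add]

/-! ## 2. The no-return law -/

/-- **NO-RETURN LAW.**  See the module docstring: `A` one step out (on `s_n, s_{n+1}`), `B` two steps out on the support, `C` home on the
support, the two exponent bookkeeping inequalities — then `A`, `B`, `C` are not unique optima at slopes `θ_A ≤ θ_B ≤ θ_C`. [this seat] -/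
theorem no_return (d : Fin K → ℕ) (v ε : Fin m → Fin m → Fin K → ℤ) {n : ℕ} (hn : 1 ≤ n)
    (s : Fin (n + 2) → Fin m) (hs : Function.Injective s)
    (A B C : Equiv.Perm (Fin m) × (Fin m → Fin K)) {θA θB θC : ℤ} (hAB : θA ≤ θB) (hBC : θB ≤ θC)
    (hdA : IsDominant d v ε θA A) (hdB : IsDominant d v ε θB B) (hdC : IsDominant d v ε θC C)
    (hB0 : B.1 (s 0) = C.1 (s (Fin.last (n + 1))))
    (hBstep : ∀ i : Fin (n + 2), (i : ℕ) < n → B.1 (s (finRotate (n + 2) i)) = C.1 (s i))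
    (hBlast : B.1 (s (Fin.last (n + 1))) = A.1 (s ⟨n, by omega⟩))
    (hAlast : A.1 (s (Fin.last (n + 1))) = C.1 (s ⟨n, by omega⟩))
    (heA : d (C.2 (s ⟨n, by omega⟩)) + d (B.2 (s (Fin.last (n + 1)))) ≤ d (A.2 (s ⟨n, by omega⟩)) + d (A.2 (s (Fin.last (n + 1)))))
    (heAB : ∑ i : Fin (n + 2), d (C.2 (s i)) ≤ ∑ i : Fin (n + 1), d (B.2 (s i.castSucc)) + d (A.2 (s (Fin.last (n + 1))))) :
    False := by
  classical
  set nn : Fin (n + 2) := ⟨n, by omega⟩ with hnn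
  set ll : Fin (n + 2) := Fin.last (n + 1) with hll
  have hnl : nn ≠ ll := by
    intro h; have := congrArg Fin.val h; simp [hnn, hll] at this
  have h0l : (0 : Fin (n + 2)) ≠ ll := by
    intro h; have := congrArg Fin.val h; simp [hll] at this
  have hrot_nn : finRotate (n + 2) nn = ll := by
    rw [hnn, hll]; ext; rw [finRotate_of_lt (by omega)]; simp
  have hrot_ll : finRotate (n + 2) ll = 0 := by rw [hll]; exact finRotate_last
  have hsinj : ∀ {i j : Fin (n + 2)}, s i = s j ↔ i = j := fun {i j} => hs.eq_iff
  -- the cyclic shift `s_i ↦ s_{i+1}` of the support columns (identity elsewhere) and the three hybrids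
  let ρ : Equiv.Perm (Fin m) := (finRotate (n + 2)).extendDomain (Equiv.ofInjective s hs)
  have ρ_apply : ∀ i, ρ (s i) = s (finRotate (n + 2) i) := by
    intro i
    have h := (finRotate (n + 2)).extendDomain_apply_image (Equiv.ofInjective s hs) i
    simpa [Equiv.ofInjective_apply] using h
  have ρ_not : ∀ {b : Fin m}, b ∉ Set.range s → ρ b = b := fun {b} hb =>
    (finRotate (n + 2)).extendDomain_apply_not_subtype (Equiv.ofInjective s hs) hb
  have ρ_symm_apply : ∀ i, ρ.symm (s (finRotate (n + 2) i)) = s i := by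
    intro i; rw [Equiv.symm_apply_eq]; exact (ρ_apply i).symm
  have ρ_symm_not : ∀ {b : Fin m}, b ∉ Set.range s → ρ.symm b = b := by
    intro b hb; rw [Equiv.symm_apply_eq]; exact (ρ_not hb).symm
  let qA : Equiv.Perm (Fin m) × (Fin m → Fin K) :=
    ((Equiv.swap (s nn) (s ll)).trans A.1,
      fun b => if b = s nn then C.2 b else if b = s ll then B.2 b else A.2 b)
  let qB : Equiv.Perm (Fin m) × (Fin m → Fin K) :=
    (ρ.trans B.1, fun b => if b = s nn then A.2 b else if b ∈ Set.range s then C.2 b else B.2 b)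
  let qC : Equiv.Perm (Fin m) × (Fin m → Fin K) :=
    (ρ.symm.trans C.1, fun b => if b = s ll then A.2 b else if b ∈ Set.range s then B.2 b else C.2 b)
  -- incidences of the hybrids, column by column
  -- (a) off the support everything is the identity
  have offA : ∀ b, b ∉ Set.range s → (qA.1 b, qA.2 b) = (A.1 b, A.2 b) := by
    intro b hb
    have h1 : b ≠ s nn := fun h => hb ⟨nn, h.symm⟩
    have h2 : b ≠ s ll := fun h => hb ⟨ll, h.symm⟩
    simp only [qA, Equiv.trans_apply, Equiv.swap_apply_of_ne_of_ne h1 h2, if_neg h1, if_neg h2]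
  have offB : ∀ b, b ∉ Set.range s → (qB.1 b, qB.2 b) = (B.1 b, B.2 b) := by
    intro b hb
    have h1 : b ≠ s nn := fun h => hb ⟨nn, h.symm⟩
    simp only [qB, Equiv.trans_apply, ρ_not hb, if_neg h1, if_neg hb]
  have offC : ∀ b, b ∉ Set.range s → (qC.1 b, qC.2 b) = (C.1 b, C.2 b) := by
    intro b hb
    have h2 : b ≠ s ll := fun h => hb ⟨ll, h.symm⟩
    simp only [qC, Equiv.trans_apply, ρ_symm_not hb, if_neg h2, if_neg hb]
  -- (b) on the support
  have memS : ∀ i, s i ∈ Set.range s := fun i => ⟨i, rfl⟩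
  have qA_nn : (qA.1 (s nn), qA.2 (s nn)) = (C.1 (s nn), C.2 (s nn)) := by
    simp only [qA, Equiv.trans_apply, Equiv.swap_apply_left]
    simp [hAlast]
  have qA_ll : (qA.1 (s ll), qA.2 (s ll)) = (B.1 (s ll), B.2 (s ll)) := by
    have h : s ll ≠ s nn := fun h => hnl (hsinj.mp h).symm
    simp only [qA, Equiv.trans_apply, Equiv.swap_apply_right, if_neg h]
    simp [hBlast]
  have qA_other : ∀ i, i ≠ nn → i ≠ ll → (qA.1 (s i), qA.2 (s i)) = (A.1 (s i), A.2 (s i)) := by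
    intro i h1 h2
    have h1' : s i ≠ s nn := fun h => h1 (hsinj.mp h)
    have h2' : s i ≠ s ll := fun h => h2 (hsinj.mp h)
    simp only [qA, Equiv.trans_apply, Equiv.swap_apply_of_ne_of_ne h1' h2', if_neg h1', if_neg h2']
  have qB_nn : (qB.1 (s nn), qB.2 (s nn)) = (A.1 (s nn), A.2 (s nn)) := by
    simp only [qB, Equiv.trans_apply, ρ_apply, hrot_nn]
    simp [hBlast]
  have qB_ll : (qB.1 (s ll), qB.2 (s ll)) = (C.1 (s ll), C.2 (s ll)) := by
    have h : s ll ≠ s nn := fun h => hnl (hsinj.mp h).symm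
    simp only [qB, Equiv.trans_apply, ρ_apply, hrot_ll, if_neg h, if_pos (memS ll), hB0]
  have qB_other : ∀ i, i ≠ nn → i ≠ ll → (qB.1 (s i), qB.2 (s i)) = (C.1 (s i), C.2 (s i)) := by
    intro i h1 h2
    have h1' : s i ≠ s nn := fun h => h1 (hsinj.mp h)
    have hi : (i : ℕ) < n := by
      have := i.isLt
      have h1'' : (i : ℕ) ≠ n := fun h => h1 (Fin.ext (by simp [hnn, h]))
      have h2'' : (i : ℕ) ≠ n + 1 := fun h => h2 (Fin.ext (by simp [hll, h]))
      omega
    simp only [qB, Equiv.trans_apply, ρ_apply, if_neg h1', if_pos (memS i), hBstep i hi]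
  -- for `qC` we index the column as `s (finRotate j)`
  have qC_rot : ∀ j, (qC.1 (s (finRotate (n + 2) j)), qC.2 (s (finRotate (n + 2) j))) =
      (C.1 (s j), if s (finRotate (n + 2) j) = s ll then A.2 (s (finRotate (n + 2) j)) else B.2 (s (finRotate (n + 2) j))) := by
    intro j
    simp only [qC, Equiv.trans_apply, ρ_symm_apply, if_pos (memS _)]
  have qC_ll : (qC.1 (s ll), qC.2 (s ll)) = (A.1 (s ll), A.2 (s ll)) := by
    have h := qC_rot nn
    rw [hrot_nn] at h
    rw [h, if_pos rfl, hAlast]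
  have qC_zero : (qC.1 (s 0), qC.2 (s 0)) = (B.1 (s 0), B.2 (s 0)) := by
    have h := qC_rot ll
    rw [hrot_ll] at h
    have h' : s 0 ≠ s ll := fun h => h0l (hsinj.mp h)
    rw [h, if_neg h', hB0]
  have qC_step : ∀ j : Fin (n + 2), (j : ℕ) < n →
      (qC.1 (s (finRotate (n + 2) j)), qC.2 (s (finRotate (n + 2) j))) =
        (B.1 (s (finRotate (n + 2) j)), B.2 (s (finRotate (n + 2) j))) := by
    intro j hj
    have h := qC_rot j
    have hne : s (finRotate (n + 2) j) ≠ s ll := by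
      intro h
      have h' := hsinj.mp h
      have hv : ((finRotate (n + 2) j : Fin (n + 2)) : ℕ) = (j : ℕ) + 1 := by
        have := finRotate_of_lt (n := n + 1) (k := j) (by omega)
        rw [show (⟨(j : ℕ), by omega⟩ : Fin (n + 2)) = j from Fin.ext rfl] at this
        rw [this]
      have := congrArg Fin.val h'
      rw [hv, hll] at this
      simp at this; omega
    rw [h, if_neg hne, hBstep j hj]
  -- every support index other than `0` is `finRotate j` for some `j` with `j < n` or `j = nn`
  have cover : ∀ i : Fin (n + 2), i ≠ nn → i ≠ ll → i ≠ 0 →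
      ∃ j : Fin (n + 2), (j : ℕ) < n ∧ finRotate (n + 2) j = i := by
    intro i h1 h2 h3
    have hi1 : (i : ℕ) ≠ n := fun h => h1 (Fin.ext (by simp [hnn, h]))
    have hi2 : (i : ℕ) ≠ n + 1 := fun h => h2 (Fin.ext (by simp [hll, h]))
    have hi3 : (i : ℕ) ≠ 0 := fun h => h3 (Fin.ext (by simp [h]))
    have hlt := i.isLt
    refine ⟨⟨(i : ℕ) - 1, by omega⟩, by simp; omega, ?_⟩
    ext
    rw [finRotate_of_lt (by simp; omega)]
    simp; omega
  -- the terms, indexed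
  let P : ℕ → Equiv.Perm (Fin m) × (Fin m → Fin K) := fun j => if j = 0 then A else if j = 1 then B else C
  let Q : ℕ → Equiv.Perm (Fin m) × (Fin m → Fin K) := fun j => if j = 0 then qA else if j = 1 then qB else qC
  let θ : ℕ → ℤ := fun j => if j = 0 then θA else if j = 1 then θB else θC
  have hP0 : P 0 = A := rfl; have hP1 : P 1 = B := rfl; have hP2 : P 2 = C := rfl
  have hQ0 : Q 0 = qA := rfl; have hQ1 : Q 1 = qB := rfl; have hQ2 : Q 2 = qC := rfl
  -- hypotheses of the multi-exchange law
  have hθ : ∀ i, i + 1 < 3 → θ i ≤ θ (i + 1) := by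
    intro i hi
    have hi2 : i < 2 := by omega
    interval_cases i
    · exact hAB
    · exact hBC
  have hdom : ∀ j, j < 3 → IsDominant d v ε (θ j) (P j) := by
    intro j hj
    interval_cases j
    · exact hdA
    · exact hdB
    · exact hdC
  -- presence of the hybrids: every incidence is an incidence of `A`, `B` or `C`
  have epsA := LacunarySymmetroidMatrixDescartes.TropicalCensus.present_of_termSign_ne_zero ε A hdA.1; have epsB := LacunarySymmetroidMatrixDescartes.TropicalCensus.present_of_termSign_ne_zero ε B hdB.1
  have epsC := LacunarySymmetroidMatrixDescartes.TropicalCensus.present_of_termSign_ne_zero ε C hdC.1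
  have inc_cases : ∀ b, ((qA.1 b, qA.2 b) = (A.1 b, A.2 b) ∧ (qB.1 b, qB.2 b) = (B.1 b, B.2 b) ∧ (qC.1 b, qC.2 b) = (C.1 b, C.2 b)) ∨
      ((qA.1 b, qA.2 b) = (C.1 b, C.2 b) ∧ (qB.1 b, qB.2 b) = (A.1 b, A.2 b) ∧ (qC.1 b, qC.2 b) = (B.1 b, B.2 b)) ∨
      ((qA.1 b, qA.2 b) = (B.1 b, B.2 b) ∧ (qB.1 b, qB.2 b) = (C.1 b, C.2 b) ∧ (qC.1 b, qC.2 b) = (A.1 b, A.2 b)) ∨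
      ((qA.1 b, qA.2 b) = (A.1 b, A.2 b) ∧ (qB.1 b, qB.2 b) = (C.1 b, C.2 b) ∧ (qC.1 b, qC.2 b) = (B.1 b, B.2 b)) := by
    intro b
    by_cases hb : b ∈ Set.range s
    · obtain ⟨i, rfl⟩ := hb
      by_cases h1 : i = nn
      · subst h1
        right; left
        refine ⟨qA_nn, qB_nn, ?_⟩
        -- `s nn = s (finRotate j)` with `j = n - 1 < n`
        have hji : finRotate (n + 2) ⟨n - 1, by omega⟩ = nn := by
          rw [finRotate_of_lt (by omega)]; ext; simp [hnn]; omega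
        rw [← hji]; exact qC_step _ (by simp; omega)
      by_cases h2 : i = ll
      · subst h2
        right; right; left
        exact ⟨qA_ll, qB_ll, qC_ll⟩
      right; right; right
      refine ⟨qA_other i h1 h2, qB_other i h1 h2, ?_⟩
      by_cases h3 : i = 0
      · subst h3; exact qC_zero
      · obtain ⟨j, hj, hji⟩ := cover i h1 h2 h3
        rw [← hji]; exact qC_step j hj
    · left
      exact ⟨offA b hb, offB b hb, offC b hb⟩
  -- transport of presence along an incidence equality
  have pres : ∀ (q X : Equiv.Perm (Fin m) × (Fin m → Fin K)) (b : Fin m),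
      (q.1 b, q.2 b) = (X.1 b, X.2 b) → ε (X.1 b) b (X.2 b) ≠ 0 → ε (q.1 b) b (q.2 b) ≠ 0 := by
    intro q X b h hX
    obtain ⟨h1, h2⟩ := Prod.mk.inj h
    rw [h1, h2]; exact hX
  have hQ : ∀ j, j < 3 → termSign ε (Q j) ≠ 0 := by
    intro j hj
    interval_cases j
    · refine AtomBudget.termSign_ne_zero_of_cells ε qA fun b => ?_
      rcases inc_cases b with ⟨h, -, -⟩ | ⟨h, -, -⟩ | ⟨h, -, -⟩ | ⟨h, -, -⟩
      · exact pres qA A b h (epsA b)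
      · exact pres qA C b h (epsC b)
      · exact pres qA B b h (epsB b)
      · exact pres qA A b h (epsA b)
    · refine AtomBudget.termSign_ne_zero_of_cells ε qB fun b => ?_
      rcases inc_cases b with ⟨-, h, -⟩ | ⟨-, h, -⟩ | ⟨-, h, -⟩ | ⟨-, h, -⟩
      · exact pres qB B b h (epsB b)
      · exact pres qB A b h (epsA b)
      · exact pres qB C b h (epsC b)
      · exact pres qB C b h (epsC b)
    · refine AtomBudget.termSign_ne_zero_of_cells ε qC fun b => ?_
      rcases inc_cases b with ⟨-, -, h⟩ | ⟨-, -, h⟩ | ⟨-, -, h⟩ | ⟨-, -, h⟩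
      · exact pres qC C b h (epsC b)
      · exact pres qC B b h (epsB b)
      · exact pres qC A b h (epsA b)
      · exact pres qC B b h (epsB b)
  have hne : ∃ j, j < 3 ∧ Q j ≠ P j := by
    refine ⟨0, by norm_num, ?_⟩
    rw [hQ0, hP0]
    intro h
    have h1 : qA.1 (s nn) = A.1 (s nn) := by rw [h]
    have h2 : qA.1 (s nn) = C.1 (s nn) := (Prod.mk.inj qA_nn).1
    rw [h2, ← hAlast] at h1
    exact hnl.symm (hsinj.mp (A.1.injective h1))
  have hinc : ∀ (b : Fin m) (al : Fin m × Fin K),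
      ((range 3).filter fun j => ((P j).1 b, (P j).2 b) = al).card =
        ((range 3).filter fun j => ((Q j).1 b, (Q j).2 b) = al).card := by
    intro b al
    rw [card_filter_range_three, card_filter_range_three]
    simp only [hP0, hP1, hP2, hQ0, hQ1, hQ2]
    rcases inc_cases b with ⟨h1, h2, h3⟩ | ⟨h1, h2, h3⟩ | ⟨h1, h2, h3⟩ | ⟨h1, h2, h3⟩ <;>
      · (rw [h1, h2, h3]) <;> split_ifs <;> omega
  -- the multi-exchange law
  obtain ⟨j, hj, hlt⟩ := MultiExchange.prefix_deficit d v ε 3 θ P Q hθ hdom hQ hne hinc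
  have hj2 : j < 2 := by omega
  -- slope bookkeeping: the class of each hybrid at each column
  have clA : ∀ b, (d (qA.2 b) : ℤ) - d (A.2 b) =
      if b = s nn then (d (C.2 (s nn)) : ℤ) - d (A.2 (s nn)) else if b = s ll then (d (B.2 (s ll)) : ℤ) - d (A.2 (s ll)) else 0 := by
    intro b
    by_cases h1 : b = s nn
    · subst h1; simp [qA]
    · by_cases h2 : b = s ll
      · subst h2; simp [qA, h1]
      · simp [qA, h1, h2]
  have clAB : ∀ b, (d (qA.2 b) : ℤ) + d (qB.2 b) - d (A.2 b) - d (B.2 b) =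
      if b ∈ Set.range s then (if b = s ll then (d (C.2 b) : ℤ) - d (A.2 b) else (d (C.2 b) : ℤ) - d (B.2 b)) else 0 := by
    intro b
    by_cases hb : b ∈ Set.range s
    · rw [if_pos hb]
      by_cases h1 : b = s nn
      · subst h1
        have h : s nn ≠ s ll := fun h => hnl (hsinj.mp h)
        simp [qA, qB, h]
      · by_cases h2 : b = s ll
        · subst h2; simp [qA, qB, h1, memS]; ring
        · simp [qA, qB, h1, h2, hb]
    · rw [if_neg hb]
      have h1 : b ≠ s nn := fun h => hb ⟨nn, h.symm⟩
      have h2 : b ≠ s ll := fun h => hb ⟨ll, h.symm⟩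
      simp [qA, qB, h1, h2, hb]
  -- sums over all columns reduce to sums over the support
  have sum_range : ∀ g : Fin m → ℤ, (∀ b, b ∉ Set.range s → g b = 0) → ∑ b, g b = ∑ i, g (s i) := by
    intro g hg
    rw [← Finset.sum_image (f := g) (s := (univ : Finset (Fin (n + 2)))) (g := s) (fun i _ j _ h => hs h)]
    symm
    apply Finset.sum_subset (Finset.subset_univ _)
    intro b _ hb
    apply hg
    intro ⟨i, hi⟩
    exact hb (Finset.mem_image.mpr ⟨i, Finset.mem_univ _, hi⟩)
  interval_cases j
  · -- prefix `{A}` versus `{qA}`: contradicts `heA`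
    simp only [zero_add, Finset.sum_range_one, hP0, hQ0] at hlt
    have hdiff : ∑ b, ((d (qA.2 b) : ℤ) - d (A.2 b)) = (d (C.2 (s nn)) : ℤ) - d (A.2 (s nn)) + ((d (B.2 (s ll)) : ℤ) - d (A.2 (s ll))) := by
      rw [sum_range _ (by
        intro b hb
        have h1 : b ≠ s nn := fun h => hb ⟨nn, h.symm⟩
        have h2 : b ≠ s ll := fun h => hb ⟨ll, h.symm⟩
        rw [clA, if_neg h1, if_neg h2])]
      simp_rw [clA]
      rw [← Finset.add_sum_erase _ _ (Finset.mem_univ nn), if_pos rfl,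
        ← Finset.add_sum_erase _ _ (Finset.mem_erase.mpr ⟨hnl.symm, Finset.mem_univ ll⟩)]
      have h : s ll ≠ s nn := fun h => hnl (hsinj.mp h).symm
      rw [if_neg h, if_pos rfl]
      rw [Finset.sum_eq_zero (fun i hi => ?_)]
      · ring
      · obtain ⟨hi1, hi2⟩ : i ≠ ll ∧ i ≠ nn := by simpa [Finset.mem_erase] using hi
        rw [if_neg (fun h => hi2 (hsinj.mp h)), if_neg (fun h => hi1 (hsinj.mp h))]
    have : ∑ b, ((d (qA.2 b) : ℤ) - d (A.2 b)) > 0 := by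
      rw [Finset.sum_sub_distrib]; linarith
    rw [hdiff] at this
    have heA' : (d (C.2 (s nn)) : ℤ) + d (B.2 (s ll)) ≤ d (A.2 (s nn)) + d (A.2 (s ll)) := by exact_mod_cast heA
    linarith
  · -- prefix `{A, B}` versus `{qA, qB}`: contradicts `heAB`
    simp only [Finset.sum_range_succ, Finset.sum_range_zero, zero_add, hP0, hQ0, hP1, hQ1] at hlt
    have hdiff : ∑ b, ((d (qA.2 b) : ℤ) + d (qB.2 b) - d (A.2 b) - d (B.2 b)) =
        ∑ i : Fin (n + 2), (if s i = s ll then (d (C.2 (s i)) : ℤ) - d (A.2 (s i)) else (d (C.2 (s i)) : ℤ) - d (B.2 (s i))) := by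
      rw [sum_range _ (by intro b hb; rw [clAB, if_neg hb])]
      refine Finset.sum_congr rfl fun i _ => ?_
      rw [clAB, if_pos (memS i)]
    have hsplit : ∑ i : Fin (n + 2), (if s i = s ll then (d (C.2 (s i)) : ℤ) - d (A.2 (s i)) else (d (C.2 (s i)) : ℤ) - d (B.2 (s i)))
        = ∑ i : Fin (n + 1), ((d (C.2 (s i.castSucc)) : ℤ) - d (B.2 (s i.castSucc))) + ((d (C.2 (s ll)) : ℤ) - d (A.2 (s ll))) := by
      rw [Fin.sum_univ_castSucc, hll, if_pos rfl]
      congr 1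
      refine Finset.sum_congr rfl fun i _ => ?_
      have : s i.castSucc ≠ s (Fin.last (n + 1)) := fun h => (Fin.castSucc_lt_last i).ne (hsinj.mp h)
      rw [if_neg this]
    have hpos : ∑ b, ((d (qA.2 b) : ℤ) + d (qB.2 b) - d (A.2 b) - d (B.2 b)) > 0 := by
      have : ∑ b, ((d (qA.2 b) : ℤ) + d (qB.2 b) - d (A.2 b) - d (B.2 b)) =
          (∑ b, (d (qA.2 b) : ℤ)) + (∑ b, (d (qB.2 b) : ℤ)) - (∑ b, (d (A.2 b) : ℤ)) - ∑ b, (d (B.2 b) : ℤ) := by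
        simp only [Finset.sum_sub_distrib, Finset.sum_add_distrib]
      rw [this]; linarith
    rw [hdiff, hsplit] at hpos
    have hC : ∑ i : Fin (n + 2), (d (C.2 (s i)) : ℤ) = ∑ i : Fin (n + 1), (d (C.2 (s i.castSucc)) : ℤ) + d (C.2 (s ll)) := by
      rw [Fin.sum_univ_castSucc, hll]
    have heAB' : (∑ i : Fin (n + 2), (d (C.2 (s i)) : ℤ)) ≤ (∑ i : Fin (n + 1), (d (B.2 (s i.castSucc)) : ℤ)) + d (A.2 (s ll)) := by
      rw [hll]; exact_mod_cast heAB
    rw [hC] at heAB'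
    rw [Finset.sum_sub_distrib] at hpos
    linarith

/-- **NO-RETURN LAW, pointwise bookkeeping**: home classes exponent-minimal column by column (`C` against `B` on `s₀ … s_n`, against `A` on `s_{n+1}`)
and the two-cell inequality at `s_n, s_{n+1}`. [this seat] -/
theorem no_return_uniform (d : Fin K → ℕ) (v ε : Fin m → Fin m → Fin K → ℤ) {n : ℕ} (hn : 1 ≤ n)
    (s : Fin (n + 2) → Fin m) (hs : Function.Injective s)
    (A B C : Equiv.Perm (Fin m) × (Fin m → Fin K)) {θA θB θC : ℤ} (hAB : θA ≤ θB) (hBC : θB ≤ θC)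
    (hdA : IsDominant d v ε θA A) (hdB : IsDominant d v ε θB B) (hdC : IsDominant d v ε θC C)
    (hB0 : B.1 (s 0) = C.1 (s (Fin.last (n + 1))))
    (hBstep : ∀ i : Fin (n + 2), (i : ℕ) < n → B.1 (s (finRotate (n + 2) i)) = C.1 (s i))
    (hBlast : B.1 (s (Fin.last (n + 1))) = A.1 (s ⟨n, by omega⟩))
    (hAlast : A.1 (s (Fin.last (n + 1))) = C.1 (s ⟨n, by omega⟩))
    (heA : d (C.2 (s ⟨n, by omega⟩)) + d (B.2 (s (Fin.last (n + 1)))) ≤ d (A.2 (s ⟨n, by omega⟩)) + d (A.2 (s (Fin.last (n + 1)))))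
    (hCB : ∀ i : Fin (n + 1), d (C.2 (s i.castSucc)) ≤ d (B.2 (s i.castSucc)))
    (hCA : d (C.2 (s (Fin.last (n + 1)))) ≤ d (A.2 (s (Fin.last (n + 1))))) : False := by
  refine no_return d v ε hn s hs A B C hAB hBC hdA hdB hdC hB0 hBstep hBlast hAlast heA ?_
  rw [Fin.sum_univ_castSucc]
  exact Nat.add_le_add (Finset.sum_le_sum fun i _ => hCB i) hCA

end NoReturn

end Summit.ValiantsHypothesis.ValiantsHypothesis.Theorems.KPlusLogSqLaw
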